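import Summits.AtomisticToContinuum.Crystallization.Theses.LaminarSixThreeThree

/-!
# Birth skeleton (BC3) — crux `LaminarSixThreeThree.LaminarSaturation`
(item stmt-AtomisticToContinuum-14294, route route-AtomisticToContinuum-LaminarSixThreeThree,
sub-problem Crystallization).  Skeleton registrar, 2026-08-17.

THE CRUX.  `LaminarSaturation : LjLaminarity → ∀ R ≥ 2, ε > 0`, in every sequence of Lennard-Jones
ground states the fraction of particles WITHOUT a GOOD `(R, ε)`-window (levels `ε`-flat on `B(xᵢ, R)`,
pairwise separation `≥ 19/20` there, and exactly `6 + 3 + 3` unit bonds with `ε`-sharp lengths `a`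
(in-layer) / `b` (inter-layer) at every particle of `B(xᵢ, R/2)`) tends to `0`.

THE CUT (the route's own two-layer plan "LaminarSaturation ⇐ LaminarLocalEnergyInequality →
BudgetCount", made precise; two finite-`N`, deterministic, checkable stubs + a kernel-checked assembly):

* `stub_energyGap` — LAMINAR LOCAL ENERGY INEQUALITY at the smallest window radius `2` (the
  load-bearing, XL stub; technique: site-localised LJ energy with a two-shell tail functional, the landed
  `LaminarKissingCap` (item 14297) for `≤ 12` bonds at laminar sites, elastic coercivity for sharpness, LJ
  stability for the rest).  For every `ε > 0` there are a laminarity scale `(t, R₀)`, a gap `γ > 0`, a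
  stability constant `C ≥ 0` and ONE sublinear error `s` (uniform over all ground states) with
  `γ · #{i ¬GOOD(2, ε)} ≤ (𝓔(y) − N·e*) + C · #{i ¬LAM(t, R₀)} + s N` for every LJ ground state `y` of every
  `N`; here `e* = ⨅_Q e_LJ(Q)` over periodic configurations (the constant of the PROVED `CrysEnergyLimit`,
  item 0626) and `LAM` is literally `LjLaminarity`'s predicate.  Reading: every laminar particle that is
  not saturated-and-sharp pays `γ`; a non-laminar particle may undercut `e*` by at most `C`; nothing else
  undercuts `e*` beyond `o(N)`.  Note `𝓔(y) − N·e* ≥ 0` is NOT assumed (it is true by subadditivity, not used).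
* `stub_radiusBootstrap` — RADIUS BOOTSTRAP `2 → R` (pure geometry + packing, M/L-sized; technique:
  coherence of overlapping local frames — normals, levels, bond lengths drift by `O(ε')` per bond step, so
  `ε' ≲ ε/R²` suffices — plus the reverse-neighbour packing count from the PROVED uniform minimal distance
  `Literature…LennardJonesMinimalDistance_holds`).  For `R ≥ 2, ε > 0` there are `ε', t, R' > 0, C ≥ 0` with
  `#{i ¬GOOD(R, ε)} ≤ C · (#{i ¬GOOD(2, ε')} + #{i ¬LAM(t, R')})` for every LJ ground state.
* `LaminarSaturation_of` — the assembly, sorry-free (hypotheses = the two stub signatures under their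
  name-keyed aliases `__Registered.stub_*`; `laminarSaturation_skeleton` feeds it the stubs literally): bootstrap at `(R, ε)`, energy gap at `ε'`,
  `LjLaminarity` (the crux's own hypothesis) at the two laminarity scales, `CrysEnergyLimit_holds`
  (`E(N)/N → e*`, proved in tree) through `IsGroundState.2 : 𝓔(x N) = E(N)`, the sublinear `s`, and a
  squeeze (`tendsto_density_of_gap_of_bootstrap`, ~40 lines of real analysis below).

WHY THIS CUT.  It separates the ENERGETIC content (a per-defect price inside the laminar class, where the
`r⁻⁶` tail and the `△/□` bilayer competition live — the crux's why-might-fail) from the GEOMETRIC content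
(local saturated frames glue to an `R`-window) and from the ASYMPTOTIC bookkeeping (done here, once).
Both stubs are finite-`N` inequalities, uniform over ground states: each is refutable by ONE explicit
configuration family, and neither mentions `Tendsto` of a ground-state sequence — so neither is the crux
or the summit in costume (BC3 probes `stub → LaminarSaturation`, `stub → Crystallization` by
`first | exact? | simpa | aesop` fail, see NOTES/`bc/`).  The budget side needs no stub: the proved
`CrysEnergyLimit` already gives `𝓔(x N) − N e* = o(N)` along ground states (the plan's `BudgetCount` with
`O(N^{2/3})` would only sharpen the rate).

HARDEST STUB: `stub_energyGap` (contains the localisation problem; barrier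
`Literature.Barriers.AtomisticToContinuum.LocalizedPotentialsExcludeLennardJones` is met by the freedom in
`(t, R₀)`: the prover may take the laminarity radius as large as the tail accounting needs — every
`(t, R₀)` is paid by `LjLaminarity`).  Disproof used: none on file for this crux (no `Disproof.lean`, no
`Negative/` lemmas at registration).  Signatures are fully inlined and qualified (restatable textually
from `Theorems/`); the readable `GoodWindow` / `Laminar` / `EnergyGap` / `RadiusBootstrap` below are
definitionally the inlined forms (two `Iff.rfl` examples).
-/

noncomputable section

namespace Summit.AtomisticToContinuum.Crystallization.Cruxes.LaminarSaturation.Birth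

open Filter Topology
open Literature.MathematicalPhysics.StatisticalMechanics
open Summit.AtomisticToContinuum.Crystallization.Theses.LaminarSixThreeThree

/-! ## Readable forms (definitionally the inlined signatures) -/

/-- The crux's GOOD window predicate with outer radius `R`, inner radius `r` (= `R/2` in the crux,
`1` at radius `2`) and tolerance `ε`, for a finite configuration `y` and a particle `i`. -/
def GoodWindow (R r ε : ℝ) {N : ℕ} (y : Fin N → EuclideanSpace ℝ (Fin 3)) (i : Fin N) : Prop :=
  (∃ a b : ℝ, 19 / 20 ≤ a ∧ a ≤ 1 ∧ 19 / 20 ≤ b ∧ b ≤ 1 ∧ ∃ n : EuclideanSpace ℝ (Fin 3), ‖n‖ = 1 ∧ ∃ c : ℤ → ℝ, (∀ k : ℤ, c k + 19 / 25 ≤ c (k + 1)) ∧ ∃ l : Fin N → ℤ, (∀ j : Fin N, dist (y j) (y i) ≤ R → |inner ℝ (y j - y i) n - c (l j)| ≤ ε) ∧ (∀ j k : Fin N, dist (y j) (y i) ≤ R → dist (y k) (y i) ≤ R → j ≠ k → 19 / 20 ≤ dist (y j) (y k)) ∧ ∀ j : Fin N, dist (y j) (y i) ≤ r → Nat.card {k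 : Fin N // k ≠ j ∧ l k = l j ∧ dist (y j) (y k) ≤ 1} = 6 ∧ Nat.card {k : Fin N // l k = l j + 1 ∧ dist (y j) (y k) ≤ 1} = 3 ∧ Nat.card {k : Fin N // l k = l j - 1 ∧ dist (y j) (y k) ≤ 1} = 3 ∧ ∀ k : Fin N, k ≠ j → dist (y j) (y k) ≤ 1 → (l k = l j → |dist (y j) (y k) - a| ≤ ε) ∧ (l k ≠ l j → |dist (y j) (y k) - b| ≤ ε))

/-- `LjLaminarity`'s predicate: `(t, R)`-laminar at particle `i`. -/
def Laminar (t R : ℝ) {N : ℕ} (y : Fin N → EuclideanSpace ℝ (Fin 3)) (i : Fin N) : Prop :=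
  (∃ n : EuclideanSpace ℝ (Fin 3), ‖n‖ = 1 ∧ ∃ c : ℤ → ℝ, (∀ k : ℤ, c k + 3 / 4 ≤ c (k + 1)) ∧ ∀ j : Fin N, dist (y j) (y i) ≤ R → ∃ k : ℤ, |inner ℝ (y j - y i) n - c k| ≤ t)

/-- Readable form of `stub_energyGap`. -/
def EnergyGap : Prop :=
  ∀ ε : ℝ, 0 < ε → ∃ t R₀ γ C : ℝ, 0 < t ∧ 0 < R₀ ∧ 0 < γ ∧ 0 ≤ C ∧ ∃ s : ℕ → ℝ,
    Tendsto (fun N : ℕ => s N / (N : ℝ)) atTop (𝓝 0) ∧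
    ∀ (N : ℕ) (y : Fin N → EuclideanSpace ℝ (Fin 3)), IsGroundState lennardJones y →
      γ * (Nat.card {i : Fin N // ¬ GoodWindow 2 1 ε y i} : ℝ) ≤
        (interactionEnergy lennardJones y - (N : ℝ) * (⨅ Q : Literature.MathematicalPhysics.StatisticalMechanics.PeriodicConfiguration 3, Q.energyPerParticle Literature.MathematicalPhysics.StatisticalMechanics.lennardJones)) +
          C * (Nat.card {i : Fin N // ¬ Laminar t R₀ y i} : ℝ) + s N

/-- Readable form of `stub_radiusBootstrap`. -/
def RadiusBootstrap : Prop :=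
  ∀ R ε : ℝ, 2 ≤ R → 0 < ε → ∃ ε' t R' C : ℝ, 0 < ε' ∧ 0 < t ∧ 0 < R' ∧ 0 ≤ C ∧
    ∀ (N : ℕ) (y : Fin N → EuclideanSpace ℝ (Fin 3)), IsGroundState lennardJones y →
      (Nat.card {i : Fin N // ¬ GoodWindow R (R / 2) ε y i} : ℝ) ≤
        C * ((Nat.card {i : Fin N // ¬ GoodWindow 2 1 ε' y i} : ℝ) +
          (Nat.card {i : Fin N // ¬ Laminar t R' y i} : ℝ))

/-! ## The registered stubs (`sorry` lives only here) -/

/-- **stub_energyGap** — LAMINAR LOCAL ENERGY INEQUALITY (window radius 2; XL, load-bearing).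
For every sharpness `ε > 0` there are a laminarity scale `t, R₀ > 0`, a gap `γ > 0`, a stability
constant `C ≥ 0` and a sublinear error `s` (uniform over all ground states of all `N`) such that for
every Lennard-Jones ground state `y` of `N` particles
`γ · #{i : ¬GOOD(2,ε) at i} ≤ (𝓔_LJ(y) − N·e*) + C · #{i : ¬LAM(t,R₀) at i} + s N`,
`e* = ⨅` over periodic configurations of the LJ energy per particle.  Mechanism on file: site-localised
energy (bonds within `1` priced by `V_LJ ≥ −1/12`, second shell + `r⁻⁶` tail as a two-shell density
functional), `LaminarKissingCap` (landed) caps laminar sites at `6 + 3 + 3` bonds, saturation + elastic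
coercivity give the gap, LJ stability bounds the undercut of non-laminar sites.  Why it might fail: the
tail is not bond-local (barrier LocalizedPotentialsExcludeLennardJones); a compressed / square-buckled
laminar arrangement might undercut `e*` locally by more than its share. -/
theorem stub_energyGap : ∀ ε : ℝ, 0 < ε → ∃ t R₀ γ C : ℝ, 0 < t ∧ 0 < R₀ ∧ 0 < γ ∧ 0 ≤ C ∧ ∃ s : ℕ → ℝ, Filter.Tendsto (fun N : ℕ => s N / (N : ℝ)) Filter.atTop (nhds 0) ∧ ∀ (N : ℕ) (y : Fin N → EuclideanSpace ℝ (Fin 3)), Literature.MathematicalPhysics.StatisticalMechanics.IsGroundState Literature.MathematicalPhysics.StatisticalMechanics.lennardJones y → γ * (Nat.card {i : Fin N // ¬ (∃ a b : ℝ, 19 / 20 ≤ a ∧ a ≤ 1 ∧ 19 / 20 ≤ b ∧ b ≤ 1 ∧ ∃ n : EuclideanSpace ℝ (Fin 3), ‖n‖ = 1 ∧ ∃ c : ℤ → ℝ, (∀ k : ℤ, c k + 19 / 25 ≤ c (k + 1)) ∧ ∃ l : Fin N → ℤ, (∀ j : Fin N, dist (y j) (y i) ≤ 2 → |inner ℝ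 (y j - y i) n - c (l j)| ≤ ε) ∧ (∀ j k : Fin N, dist (y j) (y i) ≤ 2 → dist (y k) (y i) ≤ 2 → j ≠ k → 19 / 20 ≤ dist (y j) (y k)) ∧ ∀ j : Fin N, dist (y j) (y i) ≤ 1 → Nat.card {k : Fin N // k ≠ j ∧ l k = l j ∧ dist (y j) (y k) ≤ 1} = 6 ∧ Nat.card {k : Fin N // l k = l j + 1 ∧ dist (y j) (y k) ≤ 1} = 3 ∧ Nat.card {k : Fin N // l k = l j - 1 ∧ dist (y j) (y k) ≤ 1} = 3 ∧ ∀ k : Fin N, k ≠ j → dist (y j) (y k) ≤ 1 → (l k = l j → |dist (y j) (y k) - a| ≤ ε) ∧ (l k ≠ l j → |dist (y j) (y k) - b| ≤ ε))} : ℝ) ≤ (Literature.MathematicalPhysics.StatisticalMechanics.interactionEnergy Literature.MathematicalPhysics.StatisticalMechanics.lennardJones y - (N : ℝ) * (⨅ Q : Literature.MathematicalPhysics.StatisticalMechanics.PeriodicConfiguration 3, Q.energyPerParticle Literature.MathematicalPhysics.StatisticalMechanics.lennardJones)) + C * (Nat.card {i : Fin N // ¬ (∃ n : EuclideanSpace ℝ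 (Fin 3), ‖n‖ = 1 ∧ ∃ c : ℤ → ℝ, (∀ k : ℤ, c k + 3 / 4 ≤ c (k + 1)) ∧ ∀ j : Fin N, dist (y j) (y i) ≤ R₀ → ∃ k : ℤ, |inner ℝ (y j - y i) n - c k| ≤ t)} : ℝ) + s N := by
  sorry

/-- **stub_radiusBootstrap** — RADIUS BOOTSTRAP `2 → R` (geometry + packing; M/L).
For `R ≥ 2`, `ε > 0` there are `ε', t, R' > 0` and `C ≥ 0` such that in every LJ ground state the number
of particles without a GOOD `(R, ε)`-window is at most `C` times (the number without a GOOD `(2, ε')`-window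
plus the number that are not `(t, R')`-laminar).  Mechanism: if every particle of `B(xᵢ, R')` has a GOOD
`(2, ε')`-window, the local frames (normal, levels, labels, bond lengths `a`, `b`) of bonded neighbours agree
up to `O(ε')` and relabelling, so they glue along bond paths to ONE frame on `B(xᵢ, R)` with flatness and
sharpness `O(R² ε') ≤ ε` (levels re-spread to keep gaps `≥ 19/25`); the exact counts `6/3/3` transfer
because labels are height-determined; otherwise some particle within `R'` of `i` is bad, and the proved
uniform minimal distance of LJ ground states (`LennardJonesMinimalDistance_holds`) bounds the number of
`i` within `R'` of a given bad particle.  Why it might fail: a GOOD-everywhere region whose bond graph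
inside `B(xᵢ, R')` is disconnected from `i` (a crack narrower than the window) — excluded, I claim, because
crack faces are unsaturated; the laminar disjunct is extra slack. -/
theorem stub_radiusBootstrap : ∀ R ε : ℝ, 2 ≤ R → 0 < ε → ∃ ε' t R' C : ℝ, 0 < ε' ∧ 0 < t ∧ 0 < R' ∧ 0 ≤ C ∧ ∀ (N : ℕ) (y : Fin N → EuclideanSpace ℝ (Fin 3)), Literature.MathematicalPhysics.StatisticalMechanics.IsGroundState Literature.MathematicalPhysics.StatisticalMechanics.lennardJones y → (Nat.card {i : Fin N // ¬ (∃ a b : ℝ, 19 / 20 ≤ a ∧ a ≤ 1 ∧ 19 / 20 ≤ b ∧ b ≤ 1 ∧ ∃ n : EuclideanSpace ℝ (Fin 3), ‖n‖ = 1 ∧ ∃ c : ℤ → ℝ, (∀ k : ℤ, c k + 19 / 25 ≤ c (k + 1)) ∧ ∃ l : Fin N → ℤ, (∀ j : Fin N, dist (y j) (y i) ≤ R → |inner ℝ (y j - y i) n - c (l j)| ≤ ε) ∧ (∀ j k : Fin N, dist (y j) (y i) ≤ R → dist (y k) (y i) ≤ R → j ≠ k → 19 / 20 ≤ dist (y j)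 (y k)) ∧ ∀ j : Fin N, dist (y j) (y i) ≤ R / 2 → Nat.card {k : Fin N // k ≠ j ∧ l k = l j ∧ dist (y j) (y k) ≤ 1} = 6 ∧ Nat.card {k : Fin N // l k = l j + 1 ∧ dist (y j) (y k) ≤ 1} = 3 ∧ Nat.card {k : Fin N // l k = l j - 1 ∧ dist (y j) (y k) ≤ 1} = 3 ∧ ∀ k : Fin N, k ≠ j → dist (y j) (y k) ≤ 1 → (l k = l j → |dist (y j) (y k) - a| ≤ ε) ∧ (l k ≠ l j → |dist (y j) (y k) - b| ≤ ε))} : ℝ) ≤ C * ((Nat.card {i : Fin N // ¬ (∃ a b : ℝ, 19 / 20 ≤ a ∧ a ≤ 1 ∧ 19 / 20 ≤ b ∧ b ≤ 1 ∧ ∃ n : EuclideanSpace ℝ (Fin 3), ‖n‖ = 1 ∧ ∃ c : ℤ → ℝ, (∀ k : ℤ, c k + 19 / 25 ≤ c (k + 1)) ∧ ∃ l : Fin N → ℤ, (∀ j : Fin N, dist (y j) (y i) ≤ 2 → |inner ℝ (y j - y i) n - c (l j)| ≤ ε') ∧ (∀ j k : Fin N, dist (y j) (y i) ≤ 2 →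 dist (y k) (y i) ≤ 2 → j ≠ k → 19 / 20 ≤ dist (y j) (y k)) ∧ ∀ j : Fin N, dist (y j) (y i) ≤ 1 → Nat.card {k : Fin N // k ≠ j ∧ l k = l j ∧ dist (y j) (y k) ≤ 1} = 6 ∧ Nat.card {k : Fin N // l k = l j + 1 ∧ dist (y j) (y k) ≤ 1} = 3 ∧ Nat.card {k : Fin N // l k = l j - 1 ∧ dist (y j) (y k) ≤ 1} = 3 ∧ ∀ k : Fin N, k ≠ j → dist (y j) (y k) ≤ 1 → (l k = l j → |dist (y j) (y k) - a| ≤ ε') ∧ (l k ≠ l j → |dist (y j) (y k) - b| ≤ ε'))} : ℝ) + (Nat.card {i : Fin N // ¬ (∃ n : EuclideanSpace ℝ (Fin 3), ‖n‖ = 1 ∧ ∃ c : ℤ → ℝ, (∀ k : ℤ, c k + 3 / 4 ≤ c (k + 1)) ∧ ∀ j : Fin N, dist (y j) (y i) ≤ R' → ∃ k : ℤ, |inner ℝ (y j - y i) n - c k| ≤ t)} : ℝ)) := by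
  sorry

/-! ## Name-keyed aliases of the two stub statements (hypotheses of the composition)

`__Registered.stub_X` is LITERALLY the signature of `stub_X` under the registered stub's short name, so that the
native skeleton audit (`#h21_check_skeleton`: a hypothesis is admissible iff it is a registered obligation or a
declared stub BY NAME; `__`-names are implementation details and are not themselves candidates) accepts
`LaminarSaturation_of : __Registered.stub_energyGap → __Registered.stub_radiusBootstrap → LaminarSaturation`
(device of `Cruxes/DefectFreeCrystallizes/Lines/octet-cell-squeeze.lean`); `laminarSaturation_skeleton` applies
the composition to the two `stub_…` literally, which checks that aliases and stubs agree. -/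
namespace __Registered

/-- Alias of the signature of `stub_energyGap`, keyed by the registered stub name. -/
abbrev stub_energyGap : Prop :=
  ∀ ε : ℝ, 0 < ε → ∃ t R₀ γ C : ℝ, 0 < t ∧ 0 < R₀ ∧ 0 < γ ∧ 0 ≤ C ∧ ∃ s : ℕ → ℝ, Filter.Tendsto (fun N : ℕ => s N / (N : ℝ)) Filter.atTop (nhds 0) ∧ ∀ (N : ℕ) (y : Fin N → EuclideanSpace ℝ (Fin 3)), Literature.MathematicalPhysics.StatisticalMechanics.IsGroundState Literature.MathematicalPhysics.StatisticalMechanics.lennardJones y → γ * (Nat.card {i : Fin N // ¬ (∃ a b : ℝ, 19 / 20 ≤ a ∧ a ≤ 1 ∧ 19 / 20 ≤ b ∧ b ≤ 1 ∧ ∃ n : EuclideanSpace ℝ (Fin 3), ‖n‖ = 1 ∧ ∃ c : ℤ → ℝ, (∀ k : ℤ, c k + 19 / 25 ≤ c (k + 1)) ∧ ∃ l : Fin N → ℤ, (∀ j : Fin N, dist (y j) (y i) ≤ 2 → |inner ℝ (y j - y i) n - c (l j)| ≤ ε) ∧ (∀ j k : Fin N, dist (y j) (y i) ≤ 2 → dist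 (y k) (y i) ≤ 2 → j ≠ k → 19 / 20 ≤ dist (y j) (y k)) ∧ ∀ j : Fin N, dist (y j) (y i) ≤ 1 → Nat.card {k : Fin N // k ≠ j ∧ l k = l j ∧ dist (y j) (y k) ≤ 1} = 6 ∧ Nat.card {k : Fin N // l k = l j + 1 ∧ dist (y j) (y k) ≤ 1} = 3 ∧ Nat.card {k : Fin N // l k = l j - 1 ∧ dist (y j) (y k) ≤ 1} = 3 ∧ ∀ k : Fin N, k ≠ j → dist (y j) (y k) ≤ 1 → (l k = l j → |dist (y j) (y k) - a| ≤ ε) ∧ (l k ≠ l j → |dist (y j) (y k) - b| ≤ ε))} : ℝ) ≤ (Literature.MathematicalPhysics.StatisticalMechanics.interactionEnergy Literature.MathematicalPhysics.StatisticalMechanics.lennardJones y - (N : ℝ) * (⨅ Q : Literature.MathematicalPhysics.StatisticalMechanics.PeriodicConfiguration 3, Q.energyPerParticle Literature.MathematicalPhysics.StatisticalMechanics.lennardJones)) + C * (Nat.card {i : Fin N // ¬ (∃ n : EuclideanSpace ℝ (Fin 3), ‖n‖ = 1 ∧ ∃ c : ℤ → ℝ, (∀ k : ℤ, c k + 3 /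 4 ≤ c (k + 1)) ∧ ∀ j : Fin N, dist (y j) (y i) ≤ R₀ → ∃ k : ℤ, |inner ℝ (y j - y i) n - c k| ≤ t)} : ℝ) + s N

/-- Alias of the signature of `stub_radiusBootstrap`, keyed by the registered stub name. -/
abbrev stub_radiusBootstrap : Prop :=
  ∀ R ε : ℝ, 2 ≤ R → 0 < ε → ∃ ε' t R' C : ℝ, 0 < ε' ∧ 0 < t ∧ 0 < R' ∧ 0 ≤ C ∧ ∀ (N : ℕ) (y : Fin N → EuclideanSpace ℝ (Fin 3)), Literature.MathematicalPhysics.StatisticalMechanics.IsGroundState Literature.MathematicalPhysics.StatisticalMechanics.lennardJones y → (Nat.card {i : Fin N // ¬ (∃ a b : ℝ, 19 / 20 ≤ a ∧ a ≤ 1 ∧ 19 / 20 ≤ b ∧ b ≤ 1 ∧ ∃ n : EuclideanSpace ℝ (Fin 3), ‖n‖ = 1 ∧ ∃ c : ℤ → ℝ, (∀ k : ℤ, c k + 19 / 25 ≤ c (k + 1)) ∧ ∃ l : Fin N → ℤ, (∀ j : Fin N, dist (y j) (y i) ≤ R → |inner ℝ (y j - y i) n - c (l j)| ≤ ε) ∧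 (∀ j k : Fin N, dist (y j) (y i) ≤ R → dist (y k) (y i) ≤ R → j ≠ k → 19 / 20 ≤ dist (y j) (y k)) ∧ ∀ j : Fin N, dist (y j) (y i) ≤ R / 2 → Nat.card {k : Fin N // k ≠ j ∧ l k = l j ∧ dist (y j) (y k) ≤ 1} = 6 ∧ Nat.card {k : Fin N // l k = l j + 1 ∧ dist (y j) (y k) ≤ 1} = 3 ∧ Nat.card {k : Fin N // l k = l j - 1 ∧ dist (y j) (y k) ≤ 1} = 3 ∧ ∀ k : Fin N, k ≠ j → dist (y j) (y k) ≤ 1 → (l k = l j → |dist (y j) (y k) - a| ≤ ε) ∧ (l k ≠ l j → |dist (y j) (y k) - b| ≤ ε))} : ℝ) ≤ C * ((Nat.card {i : Fin N // ¬ (∃ a b : ℝ, 19 / 20 ≤ a ∧ a ≤ 1 ∧ 19 / 20 ≤ b ∧ b ≤ 1 ∧ ∃ n : EuclideanSpace ℝ (Fin 3), ‖n‖ = 1 ∧ ∃ c : ℤ → ℝ, (∀ k : ℤ, c k + 19 / 25 ≤ c (k + 1)) ∧ ∃ l : Fin N → ℤ, (∀ j : Fin N, dist (y j) (y i) ≤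 2 → |inner ℝ (y j - y i) n - c (l j)| ≤ ε') ∧ (∀ j k : Fin N, dist (y j) (y i) ≤ 2 → dist (y k) (y i) ≤ 2 → j ≠ k → 19 / 20 ≤ dist (y j) (y k)) ∧ ∀ j : Fin N, dist (y j) (y i) ≤ 1 → Nat.card {k : Fin N // k ≠ j ∧ l k = l j ∧ dist (y j) (y k) ≤ 1} = 6 ∧ Nat.card {k : Fin N // l k = l j + 1 ∧ dist (y j) (y k) ≤ 1} = 3 ∧ Nat.card {k : Fin N // l k = l j - 1 ∧ dist (y j) (y k) ≤ 1} = 3 ∧ ∀ k : Fin N, k ≠ j → dist (y j) (y k) ≤ 1 → (l k = l j → |dist (y j) (y k) - a| ≤ ε') ∧ (l k ≠ l j → |dist (y j) (y k) - b| ≤ ε'))} : ℝ) + (Nat.card {i : Fin N // ¬ (∃ n : EuclideanSpace ℝ (Fin 3), ‖n‖ = 1 ∧ ∃ c : ℤ → ℝ, (∀ k : ℤ, c k + 3 / 4 ≤ c (k + 1)) ∧ ∀ j : Fin N, dist (y j) (y i) ≤ R' → ∃ k : ℤ, |inner ℝ (y j - y i) n - c k| ≤ t)} : ℝ))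

end __Registered

/-- The readable form IS the registered signature (definitional check). -/
example : EnergyGap ↔ __Registered.stub_energyGap := Iff.rfl

/-- The readable form IS the registered signature (definitional check). -/
example : RadiusBootstrap ↔ __Registered.stub_radiusBootstrap := Iff.rfl

/-! ## The assembly (sorry-free) -/

/-- Real-analysis core of the assembly: a density squeezed between `0` and
`C₂ · ((excess energy density + C₁ · density₂ + s/N) / γ + density₁)`, all of whose terms tend to `0`. -/
theorem tendsto_density_of_gap_of_bootstrap {f b g₁ g₂ E s : ℕ → ℝ} {γ C₁ C₂ e : ℝ}
    (hγ : 0 < γ) (hC₂ : 0 ≤ C₂)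
    (hboot : ∀ N, f N ≤ C₂ * (b N + g₁ N))
    (hgap : ∀ N, γ * b N ≤ (E N - (N : ℝ) * e) + C₁ * g₂ N + s N)
    (hf : ∀ N, 0 ≤ f N)
    (hg₁ : Tendsto (fun N : ℕ => g₁ N / (N : ℝ)) atTop (𝓝 0))
    (hg₂ : Tendsto (fun N : ℕ => g₂ N / (N : ℝ)) atTop (𝓝 0))
    (hE : Tendsto (fun N : ℕ => E N / (N : ℝ)) atTop (𝓝 e))
    (hs : Tendsto (fun N : ℕ => s N / (N : ℝ)) atTop (𝓝 0)) :
    Tendsto (fun N : ℕ => f N / (N : ℝ)) atTop (𝓝 0) := by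
  -- the upper envelope and its limit
  have hup : Tendsto (fun N : ℕ =>
      C₂ * (((E N / (N : ℝ) - e) + C₁ * (g₂ N / (N : ℝ)) + s N / (N : ℝ)) / γ + g₁ N / (N : ℝ)))
      atTop (𝓝 0) := by
    have h1 : Tendsto (fun N : ℕ => E N / (N : ℝ) - e) atTop (𝓝 0) := by
      simpa using hE.sub_const e
    have h2 := (((h1.add (hg₂.const_mul C₁)).add hs).div_const γ).add hg₁
    simpa using h2.const_mul C₂
  refine tendsto_of_tendsto_of_tendsto_of_le_of_le' tendsto_const_nhds hup ?_ ?_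
  · exact Filter.Eventually.of_forall fun N => div_nonneg (hf N) (Nat.cast_nonneg N)
  · filter_upwards [Filter.eventually_gt_atTop 0] with N hN
    have hN : (0 : ℝ) < N := Nat.cast_pos.mpr hN
    have hN' : (N : ℝ) ≠ 0 := hN.ne'
    have hγ' : γ ≠ 0 := hγ.ne'
    have hb : b N ≤ ((E N - (N : ℝ) * e) + C₁ * g₂ N + s N) / γ := by
      rw [le_div_iff₀ hγ]
      linarith [hgap N]
    have hfN : f N ≤ C₂ * (((E N - (N : ℝ) * e) + C₁ * g₂ N + s N) / γ + g₁ N) :=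
      (hboot N).trans (mul_le_mul_of_nonneg_left (add_le_add hb le_rfl) hC₂)
    have hdiv : f N / (N : ℝ) ≤ C₂ * (((E N - (N : ℝ) * e) + C₁ * g₂ N + s N) / γ + g₁ N) / (N : ℝ) :=
      div_le_div_of_nonneg_right hfN hN.le
    refine hdiv.trans (le_of_eq ?_)
    field_simp

/-- **Assembly / composition, BY NAME.** The two stubs (through their name-keyed aliases, which are their
signatures verbatim) imply the crux `LaminarSixThreeThree.LaminarSaturation`; no `sorry` in its cone.
Proof: bootstrap at `(R, ε)`; energy gap at the bootstrap's `ε'`; `LjLaminarity` (the crux's own hypothesis)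
at the two laminarity scales; `CrysEnergyLimit_holds` moved from `E(N)` to `𝓔(x N)` by `IsGroundState.2`;
the sublinear error; squeeze. -/
theorem LaminarSaturation_of (hE : __Registered.stub_energyGap) (hB : __Registered.stub_radiusBootstrap) :
    Summit.AtomisticToContinuum.Crystallization.Theses.LaminarSixThreeThree.LaminarSaturation := by
  intro hLam R ε hR hε x hx
  obtain ⟨ε', t₁, R₁, C₂, hε', ht₁, hR₁, hC₂, hboot⟩ := hB R ε hR hε
  obtain ⟨t₂, R₂, γ, C₁, ht₂, hR₂, hγ, _hC₁, s, hs, hgap⟩ := hE ε' hε'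
  have h0 : Tendsto (fun N : ℕ => groundStateEnergy lennardJones 3 N / (N : ℝ)) atTop
      (𝓝 (⨅ Q : Literature.MathematicalPhysics.StatisticalMechanics.PeriodicConfiguration 3, Q.energyPerParticle Literature.MathematicalPhysics.StatisticalMechanics.lennardJones)) :=
    CrysEnergyLimit_holds
  exact tendsto_density_of_gap_of_bootstrap hγ hC₂ (fun N => hboot N (x N) (hx N))
    (fun N => hgap N (x N) (hx N)) (fun N => Nat.cast_nonneg _) (hLam t₁ R₁ ht₁ hR₁ x hx)
    (hLam t₂ R₂ ht₂ hR₂ x hx) (h0.congr fun N => by rw [(hx N).2]) hs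

/-- **The skeleton, end to end**: the crux from the two registered stubs literally (`sorry` enters only
through `stub_energyGap`, `stub_radiusBootstrap`; replacing each by its landed proof closes the crux). -/
theorem laminarSaturation_skeleton : Summit.AtomisticToContinuum.Crystallization.Theses.LaminarSixThreeThree.LaminarSaturation :=
  LaminarSaturation_of stub_energyGap stub_radiusBootstrap

end Summit.AtomisticToContinuum.Crystallization.Cruxes.LaminarSaturation.Birth

end
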